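import Mathlib

/-!
# Hodge-locus census — RANK DOES NOT DROP UNDER LIFTING FROM A REDUCTION (the "mod p ≤ exact" certificate)
(def-free helper of `stmt-HodgeConjecture-16267`; pub-hlocus, seat ivhs-2, gen 28)

The elementary principle behind every "mod-p lower bound / exact upper bound" rank certificate of the census engines
(ENGINE A of the lead, ENGINE B `code/engineB/sparserank.py`, the gen-28 SANDWICH CERTIFICATES `pub-hlocus-ivhs-2/gen28/alldeg/sandwichB.py`
for the rows `d = 4, k = 7, 8`): for a matrix `A` with entries in a commutative ring `R` (in the census `R = ℤ[ζ_{2d}]`), any ring map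
`φ : R → L` to a field (reduction modulo a prime above `p ≡ 1 (mod 2d)`) and an INJECTIVE ring map `ι : R → K` to a field
(`K = ℚ(ζ_{2d})`):

* `rank_L (φ A) ≤ rank_K (ι A)` (`rank_map_le_rank_map_of_injective`), hence also `rank_L (S · φ A · T) ≤ rank_K (ι A)` for arbitrary
  sketching matrices `S, T` over `L` (`rank_sketch_map_le`): a rank computed (or sketched) modulo `p` is a certified LOWER bound in characteristic 0;
* `rank_K (M) + s ≤ #columns` whenever `s` linearly independent exact kernel vectors of `M` are exhibited (`rank_add_le_card_of_linearIndependent_ker`):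
  exactly verified kernel vectors are a certified UPPER bound; and the census's sharper EXCESS form (`excess_ge_of_lifted`,
  `rank_add_le_rank_fromRows_of_lifted`): with `c := rank [A; B]` (stacked) and `r(λ) := rank (A + λ B)`, `s` exhibited vectors of `ker (A + λ B)` whose
  images under `A` are linearly independent (independence modulo `ker A ∩ ker B`) give `r(λ) + s ≤ c`, i.e. the census key `e(λ) = c - r(λ) ≥ s`.

Proof of the first item: a nonzero `r × r` minor of `φ A` is `φ` of the corresponding minor of `A`, which is therefore nonzero, stays nonzero
under `ι`, and makes the corresponding `r` columns of `ι A` independent.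

certified instances and evidence bearing on the general Hodge conjecture; no claim.
-/

namespace Summit.HodgeConjecture.HodgeConjecture.HodgeLocus.Census.RankReduction

open Matrix Module Submodule

variable {R K L : Type*} [CommRing R] [Field K] [Field L]
variable {m n : Type*} [Fintype m] [Fintype n]

omit [Fintype m] [Fintype n] in
/-- Columns whose restriction to some set of rows is linearly independent are linearly independent. -/
theorem linearIndependent_cols_of_submatrix {κ : Type*} (B : Matrix m n K) (rows : κ → m) (a : κ → n)
    (h : LinearIndependent K (B.submatrix rows a).col) : LinearIndependent K (fun k => B.col (a k)) := by
  refine LinearIndependent.of_comp (LinearMap.funLeft K K rows) ?_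
  have e : (⇑(LinearMap.funLeft K K rows) ∘ fun k => B.col (a k)) = (B.submatrix rows a).col := by
    funext k i; rfl
  rw [e]; exact h

/-- If some square submatrix of `B` (rows `rows`, columns `a`, both indexed by `κ`) has nonzero determinant, then `rank B ≥ |κ|`. -/
theorem card_le_rank_of_det_submatrix_ne_zero {κ : Type*} [Fintype κ] [DecidableEq κ] (B : Matrix m n K)
    (rows : κ → m) (a : κ → n) (h : (B.submatrix rows a).det ≠ 0) : Fintype.card κ ≤ B.rank := by
  have hU : IsUnit (B.submatrix rows a) :=
    (Matrix.isUnit_iff_isUnit_det _).mpr (isUnit_iff_ne_zero.mpr h)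
  have hcols : LinearIndependent K (fun k => B.col (a k)) :=
    linearIndependent_cols_of_submatrix B rows a (Matrix.linearIndependent_cols_iff_isUnit.mpr hU)
  rw [rank_eq_finrank_span_cols, ← finrank_span_eq_card hcols]
  exact Submodule.finrank_mono (span_mono (by rintro _ ⟨k, rfl⟩; exact ⟨a k, rfl⟩))

/-- Over a field, a matrix of rank `r` has an `r × r` submatrix with nonzero determinant. -/
theorem exists_submatrix_det_ne_zero (B : Matrix m n L) :
    ∃ (rows : Fin B.rank → m) (a : Fin B.rank → n), (B.submatrix rows a).det ≠ 0 := by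
  classical
  -- independent columns
  obtain ⟨κ, a, ha, hspan, hli⟩ := exists_linearIndependent' L B.col
  haveI : Fintype κ := Fintype.ofInjective a ha
  set C : Matrix m κ L := B.submatrix id a with hC
  have hliC : LinearIndependent L C.col := hli
  have hrankB : B.rank = Fintype.card κ := by
    rw [rank_eq_finrank_span_cols, ← hspan]; exact finrank_span_eq_card hli
  have hrankC : C.rank = Fintype.card κ := by
    rw [rank_eq_finrank_span_cols]; exact finrank_span_eq_card hliC
  -- independent rows of the column-submatrix
  obtain ⟨κ₂, b, hb, hspan2, hli2⟩ := exists_linearIndependent' L C.row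
  haveI : Fintype κ₂ := Fintype.ofInjective b hb
  have hcard : Fintype.card κ₂ = Fintype.card κ := by
    rw [← finrank_span_eq_card hli2, hspan2, ← rank_eq_finrank_span_row, hrankC]
  let e : κ₂ ≃ κ := Fintype.equivOfCardEq hcard
  let rows : κ → m := b ∘ e.symm
  have hrows : LinearIndependent L (B.submatrix rows a).row := by
    have h3 : LinearIndependent L ((C.row ∘ b) ∘ e.symm) := hli2.comp _ e.symm.injective
    have h4 : (B.submatrix rows a).row = (C.row ∘ b) ∘ e.symm := by
      funext k j; rfl
    rw [h4]; exact h3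
  have hU : IsUnit (B.submatrix rows a) := Matrix.linearIndependent_rows_iff_isUnit.mp hrows
  have hdet : (B.submatrix rows a).det ≠ 0 := ((Matrix.isUnit_iff_isUnit_det _).mp hU).ne_zero
  -- reindex by `Fin B.rank`
  let f : κ ≃ Fin B.rank := Fintype.equivFinOfCardEq hrankB.symm
  refine ⟨rows ∘ f.symm, a ∘ f.symm, ?_⟩
  have h5 : B.submatrix (rows ∘ f.symm) (a ∘ f.symm) = (B.submatrix rows a).submatrix f.symm f.symm := by
    funext i j; rfl
  rw [h5, Matrix.det_submatrix_equiv_self]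
  exact hdet

/-- RANK DOES NOT DROP UNDER LIFTING: for `A` over `R`, a ring map `φ : R → L` to a field and an injective ring map
`ι : R → K` to a field, `rank (φ A) ≤ rank (ι A)`.  (Census: `R = ℤ[ζ]`, `φ` = reduction mod a prime above `p`, `ι` = inclusion
into `ℚ(ζ)`: a modular rank is a certified lower bound for the exact rank.) -/
theorem rank_map_le_rank_map_of_injective (φ : R →+* L) (ι : R →+* K) (hι : Function.Injective ι)
    (A : Matrix m n R) : (A.map φ).rank ≤ (A.map ι).rank := by
  classical
  obtain ⟨rows, a, hdet⟩ := exists_submatrix_det_ne_zero (A.map φ)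
  rw [← Fintype.card_fin (A.map φ).rank]
  apply card_le_rank_of_det_submatrix_ne_zero (A.map ι) rows a
  -- the minor over `R`
  have hφ : ((A.map φ).submatrix rows a).det = φ (A.submatrix rows a).det := by
    rw [submatrix_map, RingHom.map_det, RingHom.mapMatrix_apply]
  have hιdet : ((A.map ι).submatrix rows a).det = ι (A.submatrix rows a).det := by
    rw [submatrix_map, RingHom.map_det, RingHom.mapMatrix_apply]
  have hR : (A.submatrix rows a).det ≠ 0 := by
    intro h0; apply hdet; rw [hφ, h0, map_zero]
  rw [hιdet]
  exact fun h0 => hR ((injective_iff_map_eq_zero ι).mp hι _ h0)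

/-- SKETCHED MODULAR RANK IS A LOWER BOUND: `rank (S · φA · T) ≤ rank (ι A)` for arbitrary matrices `S, T` over `L`. -/
theorem rank_sketch_map_le {m' n' : Type*} [Fintype m'] [Fintype n'] (φ : R →+* L) (ι : R →+* K)
    (hι : Function.Injective ι) (A : Matrix m n R) (S : Matrix m' m L) (T : Matrix n n' L) :
    (S * A.map φ * T).rank ≤ (A.map ι).rank :=
  ((rank_mul_le_left _ _).trans (rank_mul_le_right _ _)).trans (rank_map_le_rank_map_of_injective φ ι hι A)

/-- The integer / mod-`p` / rational instance used verbatim by the census engines. -/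
theorem rank_modp_le_rank_rat (p : ℕ) [Fact p.Prime] (A : Matrix m n ℤ) :
    (A.map (Int.castRingHom (ZMod p))).rank ≤ (A.map (Int.castRingHom ℚ)).rank :=
  rank_map_le_rank_map_of_injective _ _ (RingHom.injective_int (Int.castRingHom ℚ)) A

omit [Fintype m] in
/-- EXACT KERNEL VECTORS BOUND THE RANK FROM ABOVE: `s` linearly independent vectors killed by `M` give `rank M + s ≤ #columns`. -/
theorem rank_add_le_card_of_linearIndependent_ker {s : ℕ} (M : Matrix m n K) (v : Fin s → (n → K))
    (hv : LinearIndependent K v) (hker : ∀ i, M *ᵥ v i = 0) : M.rank + s ≤ Fintype.card n := by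
  have hle : span K (Set.range v) ≤ LinearMap.ker M.mulVecLin := by
    rw [span_le]; rintro _ ⟨i, rfl⟩; exact (LinearMap.mem_ker).mpr (hker i)
  have h1 : s ≤ finrank K (LinearMap.ker M.mulVecLin) := by
    have := Submodule.finrank_mono hle
    rwa [finrank_span_eq_card hv, Fintype.card_fin] at this
  have h2 := LinearMap.finrank_range_add_finrank_ker M.mulVecLin
  rw [Module.finrank_fintype_fun_eq_card] at h2
  unfold Matrix.rank
  omega

omit [Fintype m] in
/-- THE CENSUS'S EXCESS BOUND FROM LIFTED VECTORS.  With `c := rank [A; B]` (stacked) and `r(λ) := rank (A + λ B)`, the census key is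
`e(λ) := c - r(λ) = dim ker (A + λ B) - dim (ker A ∩ ker B)`.  If `s` vectors `v i ∈ ker (A + λ B)` are exhibited whose images `A (v i)` are linearly
independent (independence MODULO `ker A ∩ ker B`), then `r(λ) + s ≤ c`, i.e. `e(λ) ≥ s` — exactly the 'LIFT' step of the sandwich certificates. -/
theorem rank_add_le_rank_fromRows_of_lifted {m₂ : Type*} {s : ℕ} (A : Matrix m n K) (B : Matrix m n K)
    (A' : Matrix m₂ n K) (hA' : LinearMap.ker (Matrix.fromRows A B).mulVecLin ≤ LinearMap.ker A'.mulVecLin)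
    (c : K) (v : Fin s → (n → K)) (hker : ∀ i, (A + c • B) *ᵥ v i = 0)
    (hli : LinearIndependent K (fun i => A' *ᵥ v i)) :
    (A + c • B).rank + s ≤ (Matrix.fromRows A B).rank := by
  set U := LinearMap.ker (Matrix.fromRows A B).mulVecLin with hU
  set W := LinearMap.ker (A + c • B).mulVecLin with hW
  set V := span K (Set.range v) with hV
  -- `U ≤ W`
  have hUW : U ≤ W := by
    intro x hx
    rw [hU, LinearMap.mem_ker, Matrix.mulVecLin_apply, Matrix.fromRows_mulVec] at hx
    have hAx : A *ᵥ x = 0 := by funext i; simpa using congrFun hx (Sum.inl i)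
    have hBx : B *ᵥ x = 0 := by funext i; simpa using congrFun hx (Sum.inr i)
    rw [hW, LinearMap.mem_ker, Matrix.mulVecLin_apply, Matrix.add_mulVec, Matrix.smul_mulVec, hAx, hBx]
    simp
  -- `V ≤ W`
  have hVW : V ≤ W := by
    rw [hV, span_le]; rintro _ ⟨i, rfl⟩; exact (LinearMap.mem_ker).mpr (hker i)
  -- `U ⊓ V = ⊥`
  have hUV : U ⊓ V = ⊥ := by
    rw [eq_bot_iff]
    intro x hx
    obtain ⟨hxU, hxV⟩ := Submodule.mem_inf.mp hx
    obtain ⟨g, rfl⟩ := (Submodule.mem_span_range_iff_exists_fun K).mp hxV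
    have hx0 : A' *ᵥ (∑ i, g i • v i) = 0 := (LinearMap.mem_ker).mp (hA' hxU)
    have hlin : A' *ᵥ (∑ i, g i • v i) = ∑ i, g i • (A' *ᵥ v i) := by
      have h := map_sum A'.mulVecLin (fun i => g i • v i) Finset.univ
      simp only [map_smul, Matrix.mulVecLin_apply] at h
      exact h
    have hsum : ∑ i, g i • (A' *ᵥ v i) = 0 := by rw [← hlin]; exact hx0
    have hg : ∀ i, g i = 0 := Fintype.linearIndependent_iff.mp hli g hsum
    rw [Submodule.mem_bot]
    simp [hg]
  have hv : LinearIndependent K v :=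
    LinearIndependent.of_comp A'.mulVecLin (by simpa [Function.comp_def, Matrix.mulVecLin_apply] using hli)
  have hVs : finrank K V = s := by rw [hV, finrank_span_eq_card hv, Fintype.card_fin]
  have hsup : finrank K ↥(U ⊔ V) + finrank K ↥(U ⊓ V) = finrank K U + finrank K V :=
    Submodule.finrank_sup_add_finrank_inf_eq U V
  rw [hUV, finrank_bot] at hsup
  have hle : finrank K ↥(U ⊔ V) ≤ finrank K W := Submodule.finrank_mono (sup_le hUW hVW)
  have h1 := LinearMap.finrank_range_add_finrank_ker (Matrix.fromRows A B).mulVecLin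
  have h2 := LinearMap.finrank_range_add_finrank_ker (A + c • B).mulVecLin
  rw [Module.finrank_fintype_fun_eq_card] at h1 h2
  rw [← hU] at h1
  rw [← hW] at h2
  unfold Matrix.rank
  omega

omit [Fintype m] in
/-- The form used verbatim by `sandwichB.py`: lifted vectors in `ker (A + λ B)` whose images under `A` itself are independent give `e(λ) ≥ s`. -/
theorem excess_ge_of_lifted {s : ℕ} (A B : Matrix m n K) (c : K) (v : Fin s → (n → K))
    (hker : ∀ i, (A + c • B) *ᵥ v i = 0) (hli : LinearIndependent K (fun i => A *ᵥ v i)) :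
    (A + c • B).rank + s ≤ (Matrix.fromRows A B).rank := by
  refine rank_add_le_rank_fromRows_of_lifted A B A ?_ c v hker hli
  intro x hx
  rw [LinearMap.mem_ker, Matrix.mulVecLin_apply, Matrix.fromRows_mulVec] at hx
  rw [LinearMap.mem_ker, Matrix.mulVecLin_apply]
  funext i; simpa using congrFun hx (Sum.inl i)

end Summit.HodgeConjecture.HodgeConjecture.HodgeLocus.Census.RankReduction
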